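import Mathlib.RingTheory.Valuation.ValuationSubring
import Mathlib.RingTheory.Algebraic.Basic
import Mathlib.RingTheory.Ideal.Operations
import HarnessLib

/-!
# Valuation rings of an algebraic extension (Zariski–Samuel VI §7, Thm. 12)

Topic: `Literature/AlgebraicGeometry/Resolution` (valued function fields). Let `N | K` be an
algebraic field extension, `O` a valuation ring of `K` and `V` a valuation ring of `N` lying
over `O` (`V ∩ K = O`). Zariski–Samuel (*Commutative Algebra* II, Ch. VI §7, Thm. 12) prove that
`V` is the localisation of the integral closure `B` of `O` in `N` at the centre `𝔪_V ∩ B`. We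
vendor the elementwise heart of that proof in a form avoiding integral closures altogether:

* `exists_unit_mul_eq_of_isAlgebraic` — for `x ∈ V` algebraic over `K` there are `s, t ∈ N`
  lying in EVERY valuation subring of `N` containing `O`, with `s` a unit of `V` and `s x = t`.
  (From `f(x) = 0`: let `a_j` be the coefficient of largest value with largest index and
  `b_i = a_i / a_j ∈ O`; then `s = Σ_{i ≥ j} b_i x^{i-j} = -Σ_{i<j} b_i x^{i-j}` lies in
  `O[x] ∩ O[x⁻¹]`, hence in every valuation ring containing `O`, and `s ≡ 1 mod 𝔪_V`.) PROVED.
* `exists_le_of_forall_mem` — consequently ("valuation overrings of a finite intersection"):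
  if finitely many valuation subrings `V ∈ 𝓕` of `N` all lie over `O` and a valuation subring
  `U` contains `⋂ 𝓕`, then `U` contains some `V ∈ 𝓕` (prime avoidance for the centres
  `𝔪_V ∩ ⋂𝓕`, Mathlib `Ideal.subset_union_prime`, then the previous lemma; Engler–Prestel,
  *Valued Fields*, Thm. 3.2.7 / Bourbaki, *Alg. comm.* VI §7 no. 1 for arbitrary finite families
  of incomparable valuation rings). PROVED.

These feed the proof that the henselization is an immediate extension
(`DecompositionFieldApprox.lean`, `HenselizationProofs.lean`) and the conjugacy of the
extensions of a valuation in a Galois extension (`ValuationGaloisConjugacy.lean`).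

## Sources

* O. Zariski, P. Samuel, *Commutative Algebra* II, GTM 29, Springer 1960, Ch. VI §7, Thm. 12 and
  its proof. [ZariskiSamuel1960]
* F.-V. Kuhlmann, *Elimination of ramification I*, Trans. AMS 362 (2010), §1.1 (conjugacy of the
  extensions of `v` to `K^sep`, quoted from "[Z–S]"). [Kuhlmann2010]

## Rendering notes

* "lies over": `V.comap (algebraMap K N) = O`; "contains `O`": `∀ c ∈ O, algebraMap K N c ∈ V'`.
* No integral closure is formed: membership in `O[x] ∩ O[x⁻¹]` is replaced by the property it is
  used for, membership in every valuation subring containing `O`.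
-/

noncomputable section

open Polynomial

namespace Literature.AlgebraicGeometry.Resolution

universe u v

variable {K : Type u} {N : Type v} [Field K] [Field N] [Algebra K N]

/-! ### Units and non-units over `O` -/

/-- If `V` lies over `O`, elements of `O` map into `V`. [folklore] -/
theorem algebraMap_mem_valuationSubring_of_comap_eq {O : ValuationSubring K} {V : ValuationSubring N}
    (hV : V.comap (algebraMap K N) = O) {c : K} (hc : c ∈ O) : algebraMap K N c ∈ V := by
  rw [← hV] at hc
  exact hc

/-- If `V` lies over `O`, an element of `K` is a non-unit of `O` iff its image is a non-unit of
`V`: `V.valuation (algebraMap K N b) < 1 ↔ O.valuation b < 1`. [folklore] -/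
theorem valuation_algebraMap_lt_one_iff_comap {O : ValuationSubring K} {V : ValuationSubring N}
    (hV : V.comap (algebraMap K N) = O) (b : K) :
    V.valuation (algebraMap K N b) < 1 ↔ O.valuation b < 1 := by
  by_cases hb : b = 0
  · subst hb
    simp
  have hbN : algebraMap K N b ≠ 0 := (_root_.map_ne_zero _).mpr hb
  have key : ∀ {F : Type v} [Field F] (A : ValuationSubring F) {y : F}, y ≠ 0 →
      (A.valuation y < 1 ↔ y⁻¹ ∉ A) := by
    intro F _ A y hy
    rw [← A.valuation_le_one_iff, not_le, map_inv₀, one_lt_inv₀ ((Valuation.pos_iff _).mpr hy)]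
  have key' : ∀ (A : ValuationSubring K) {y : K}, y ≠ 0 → (A.valuation y < 1 ↔ y⁻¹ ∉ A) := by
    intro A y hy
    rw [← A.valuation_le_one_iff, not_le, map_inv₀, one_lt_inv₀ ((Valuation.pos_iff _).mpr hy)]
  rw [key V hbN, key' O hb, ← map_inv₀, ← hV, ValuationSubring.mem_comap]

/-! ### The Zariski–Samuel element -/

/-- **Zariski–Samuel VI §7, Thm. 12 (key step).** Let `V` be a valuation subring of `N` lying over
the valuation subring `O` of `K`, and `x ∈ V` algebraic over `K`. Then there are `s t : N` which
lie in every valuation subring of `N` containing `O` (they lie in `O[x] ∩ O[x⁻¹]`), such that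
`s` is a unit of `V` and `s * x = t`. In particular `V` is the localisation at its centre of the
intersection of all valuation subrings of `N` containing `O` (the integral closure of `O`).
[cite: ZariskiSamuel1960, Ch. VI §7 Thm. 12] -/
theorem exists_unit_mul_eq_of_isAlgebraic (O : ValuationSubring K) (V : ValuationSubring N)
    (hV : V.comap (algebraMap K N) = O) {x : N} (hx : x ∈ V) (halg : IsAlgebraic K x) :
    ∃ s t : N, (∀ V' : ValuationSubring N, (∀ c ∈ O, algebraMap K N c ∈ V') → s ∈ V' ∧ t ∈ V') ∧
      V.valuation s = 1 ∧ s * x = t := by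
  classical
  obtain ⟨f, hf0, hfx⟩ := halg
  set v := O.valuation with hv_def
  -- the index `j`: largest index among the coefficients of maximal value
  have hsupp : f.support.Nonempty :=
    Finset.nonempty_iff_ne_empty.mpr fun h => hf0 (Polynomial.support_eq_empty.mp h)
  set m := f.support.sup' hsupp (fun i => v (f.coeff i)) with hm_def
  set S := f.support.filter (fun i => v (f.coeff i) = m) with hS_def
  have hSne : S.Nonempty := by
    obtain ⟨i, hi, hieq⟩ := Finset.exists_mem_eq_sup' hsupp (fun i => v (f.coeff i))
    exact ⟨i, Finset.mem_filter.mpr ⟨hi, hieq.symm⟩⟩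
  set j := S.max' hSne with hj_def
  have hjS : j ∈ S := Finset.max'_mem S hSne
  have hjsupp : j ∈ f.support := (Finset.mem_filter.mp hjS).1
  have hjm : v (f.coeff j) = m := (Finset.mem_filter.mp hjS).2
  have haj : f.coeff j ≠ 0 := Polynomial.mem_support_iff.mp hjsupp
  have hle : ∀ i, v (f.coeff i) ≤ m := by
    intro i
    by_cases hi : i ∈ f.support
    · exact Finset.le_sup' (fun i => v (f.coeff i)) hi
    · rw [Polynomial.notMem_support_iff.mp hi, map_zero]
      exact zero_le
  have hm0 : m ≠ 0 := by rw [← hjm]; exact (_root_.map_ne_zero v).mpr haj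
  have hlt : ∀ i, j < i → v (f.coeff i) < m := by
    intro i hji
    by_cases hi : i ∈ f.support
    · refine lt_of_le_of_ne (hle i) fun heq => ?_
      have hiS : i ∈ S := Finset.mem_filter.mpr ⟨hi, heq⟩
      exact absurd (Finset.le_max' S i hiS) (not_le.mpr hji)
    · rw [Polynomial.notMem_support_iff.mp hi, map_zero]
      exact zero_lt_iff.mpr hm0
  -- the normalised coefficients `b i = a_i / a_j ∈ O`
  set b : ℕ → K := fun i => f.coeff i / f.coeff j with hb_def
  have hbO : ∀ i, b i ∈ O := by
    intro i
    rw [← O.valuation_le_one_iff, ← hv_def, hb_def]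
    dsimp only
    rw [map_div₀, hjm]
    exact div_le_one_of_le₀ (hle i) zero_le
  have hbj : b j = 1 := div_self haj
  have hblt : ∀ i, j < i → V.valuation (algebraMap K N (b i)) < 1 := by
    intro i hji
    rw [valuation_algebraMap_lt_one_iff_comap hV, ← hv_def, hb_def]
    dsimp only
    rw [map_div₀, hjm]
    exact (div_lt_one₀ (zero_lt_iff.mpr hm0)).mpr (hlt i hji)
  set c : ℕ → N := fun i => algebraMap K N (b i) with hc_def
  have hcmem : ∀ V' : ValuationSubring N, (∀ c ∈ O, algebraMap K N c ∈ V') → ∀ i, c i ∈ V' :=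
    fun V' hV' i => hV' _ (hbO i)
  have hcj : c j = 1 := by simp [hc_def, hbj]
  -- the relation `Σ_{i ≤ d} c i * x ^ i = 0`
  set d := f.natDegree with hd_def
  have hjd : j ≤ d := Polynomial.le_natDegree_of_mem_supp j hjsupp
  have hrel : ∑ i ∈ Finset.range (d + 1), c i * x ^ i = 0 := by
    have h1 : ∑ i ∈ Finset.range (d + 1), f.coeff i • x ^ i = 0 := by
      rw [hd_def, ← Polynomial.aeval_eq_sum_range, hfx]
    have h2 : ∑ i ∈ Finset.range (d + 1), c i * x ^ i =
        (algebraMap K N (f.coeff j))⁻¹ * ∑ i ∈ Finset.range (d + 1), f.coeff i • x ^ i := by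
      rw [Finset.mul_sum]
      refine Finset.sum_congr rfl fun i _ => ?_
      rw [hc_def, hb_def]
      dsimp only
      rw [Algebra.smul_def, map_div₀, div_eq_mul_inv, mul_comm (algebraMap K N (f.coeff i)),
        mul_assoc]
    rw [h2, h1, mul_zero]
  -- the element `s = Σ_{i ≥ j} c_i x^{i-j}`
  set s : N := ∑ i ∈ Finset.range (d + 1 - j), c (j + i) * x ^ i with hs_def
  have hsplit : ∑ i ∈ Finset.range (d + 1), c i * x ^ i =
      ∑ i ∈ Finset.range j, c i * x ^ i + x ^ j * s := by
    have : d + 1 = j + (d + 1 - j) := by omega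
    rw [this, Finset.sum_range_add, hs_def, Finset.mul_sum]
    congr 1
    refine Finset.sum_congr rfl fun i _ => ?_
    rw [pow_add]
    ring
  have hxs : x ^ j * s = -∑ i ∈ Finset.range j, c i * x ^ i := by
    rw [eq_neg_iff_add_eq_zero, add_comm, ← hsplit, hrel]
  refine ⟨s, s * x, fun V' hV' => ?_, ?_, rfl⟩
  · -- membership in every valuation subring `V'` containing `O`
    have hc' := hcmem V' hV'
    by_cases hxV' : x ∈ V'
    · have hsV' : s ∈ V' := by
        rw [hs_def]
        exact sum_mem fun i _ => mul_mem (hc' _) (pow_mem hxV' _)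
      exact ⟨hsV', mul_mem hsV' hxV'⟩
    · have hx0 : x ≠ 0 := by rintro rfl; exact hxV' V'.zero_mem
      have hxi : x⁻¹ ∈ V' := (V'.mem_or_inv_mem x).resolve_left hxV'
      have hs_alt : s = -∑ i ∈ Finset.range j, c i * (x ^ i * (x⁻¹) ^ j) := by
        have : s = (x⁻¹) ^ j * (x ^ j * s) := by
          rw [← mul_assoc, ← mul_pow, inv_mul_cancel₀ hx0, one_pow, one_mul]
        rw [this, hxs, mul_neg, Finset.mul_sum]
        congr 1
        refine Finset.sum_congr rfl fun i _ => ?_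
        ring
      have hpow : ∀ i, i ≤ j → x ^ i * (x⁻¹) ^ j = (x⁻¹) ^ (j - i) := by
        intro i hij
        calc x ^ i * (x⁻¹) ^ j = x ^ i * (x⁻¹) ^ (i + (j - i)) := by rw [Nat.add_sub_cancel' hij]
          _ = (x * x⁻¹) ^ i * (x⁻¹) ^ (j - i) := by rw [pow_add, mul_pow, mul_assoc]
          _ = (x⁻¹) ^ (j - i) := by rw [mul_inv_cancel₀ hx0, one_pow, one_mul]
      have hsV' : s ∈ V' := by
        rw [hs_alt]
        refine neg_mem (sum_mem fun i hi => mul_mem (hc' _) ?_)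
        rw [hpow i (Finset.mem_range.mp hi).le]
        exact pow_mem hxi _
      have ht_alt : s * x = -∑ i ∈ Finset.range j, c i * (x ^ (i + 1) * (x⁻¹) ^ j) := by
        rw [hs_alt, neg_mul, Finset.sum_mul]
        congr 1
        refine Finset.sum_congr rfl fun i _ => ?_
        ring
      have htV' : s * x ∈ V' := by
        rw [ht_alt]
        refine neg_mem (sum_mem fun i hi => mul_mem (hc' _) ?_)
        rw [hpow (i + 1) (Finset.mem_range.mp hi)]
        exact pow_mem hxi _
      exact ⟨hsV', htV'⟩
  · -- `s ≡ 1 mod 𝔪_V`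
    have hdj : d + 1 - j = (d - j) + 1 := by omega
    rw [hs_def, hdj, Finset.sum_range_succ', add_zero, pow_zero, mul_one, hcj]
    rw [Valuation.map_add_eq_of_lt_right (v := V.valuation) ?_, map_one]
    rw [map_one]
    refine Valuation.map_sum_lt _ one_ne_zero fun i _ => ?_
    rw [map_mul]
    calc V.valuation (c (j + (i + 1))) * V.valuation (x ^ (i + 1))
        ≤ V.valuation (c (j + (i + 1))) * 1 := by
          gcongr
          exact (V.valuation_le_one_iff _).mpr (pow_mem hx _)
      _ = V.valuation (c (j + (i + 1))) := mul_one _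
      _ < 1 := hblt _ (by omega)

/-! ### Valuation overrings of a finite intersection -/

/-- **Valuation overrings of a finite intersection.** Let `𝓕` be a nonempty finite family of
valuation subrings of the algebraic extension `N` of `K`, all lying over the same valuation
subring `O` of `K`, and let `U` be a valuation subring of `N` containing `⋂ 𝓕`. Then `U`
contains some member of `𝓕`. Proof: with `R = ⋂ 𝓕`, the centre `𝔪_U ∩ R` is contained in the
union of the primes `𝔪_V ∩ R` (`V ∈ 𝓕`) — an element of `R` which is a unit in every `V ∈ 𝓕`
is a unit of `R ⊆ U` —, hence in one of them (prime avoidance), say `𝔪_{V₁} ∩ R`; and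
`V₁ ⊆ U` by `exists_unit_mul_eq_of_isAlgebraic` (`x = t / s` with `s, t ∈ R`, `s ∉ 𝔪_{V₁}`).
(Engler–Prestel, *Valued Fields*, Thm. 3.2.7, for arbitrary incomparable families; here via
Zariski–Samuel VI §7 Thm. 12.) [cite: ZariskiSamuel1960, Ch. VI §7 Thm. 12] -/
theorem exists_le_of_forall_mem [Algebra.IsAlgebraic K N] (O : ValuationSubring K)
    (F : Finset (ValuationSubring N)) (hF : F.Nonempty)
    (hFO : ∀ V ∈ F, V.comap (algebraMap K N) = O) (U : ValuationSubring N)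
    (hU : ∀ x : N, (∀ V ∈ F, x ∈ V) → x ∈ U) : ∃ V ∈ F, V ≤ U := by
  classical
  -- the intersection `R = ⋂ 𝓕`
  let R : Subring N := ⨅ V ∈ F, (V : ValuationSubring N).toSubring
  have hR : ∀ x : N, x ∈ R ↔ ∀ V ∈ F, x ∈ V := by
    intro x
    simp only [R, Subring.mem_iInf]
    exact ⟨fun h V hV => h V hV, fun h V hV => h V hV⟩
  have hRU : ∀ x ∈ R, x ∈ U := fun x hx => hU x ((hR x).mp hx)
  -- the restriction maps `R → V`
  let φ : ∀ V : ValuationSubring N, (∀ x ∈ R, x ∈ V) → R →+* V := fun V h =>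
    { toFun := fun r => ⟨r.1, h r.1 r.2⟩
      map_one' := rfl
      map_mul' := fun _ _ => rfl
      map_zero' := rfl
      map_add' := fun _ _ => rfl }
  have hφ : ∀ (V : ValuationSubring N) (h : ∀ x ∈ R, x ∈ V) (r : R),
      r ∈ (IsLocalRing.maximalIdeal V).comap (φ V h) ↔ V.valuation (r : N) < 1 := by
    intro V h r
    rw [Ideal.mem_comap, ValuationSubring.valuation_lt_one_iff]
    rfl
  have hmemF : ∀ V : F, ∀ x ∈ R, x ∈ (V : ValuationSubring N) :=
    fun V x hx => (hR x).mp hx V V.2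
  -- the centres `𝔭_V = 𝔪_V ∩ R` and `P = 𝔪_U ∩ R`
  let p : F → Ideal R := fun V =>
    (IsLocalRing.maximalIdeal (V : ValuationSubring N)).comap (φ V (hmemF V))
  let P : Ideal R := (IsLocalRing.maximalIdeal U).comap (φ U hRU)
  -- `P ⊆ ⋃ 𝔭_V`
  have hPsub : (P : Set R) ⊆ ⋃ V ∈ (↑(Finset.univ : Finset F) : Set F), (p V : Set R) := by
    intro r hr
    have hrU : U.valuation (r : N) < 1 := (hφ U hRU r).mp hr
    by_contra hcon
    have hcon' : ∀ V : F, r ∉ p V := by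
      intro V hV
      exact hcon (Set.mem_iUnion₂.mpr ⟨V, by simp, hV⟩)
    -- `r` is a unit in every `V ∈ 𝓕`, hence `r⁻¹ ∈ R ⊆ U`
    have hr0 : (r : N) ≠ 0 := by
      intro h0
      obtain ⟨V₀, hV₀⟩ := hF
      apply hcon' ⟨V₀, hV₀⟩
      rw [hφ, h0, map_zero]
      exact zero_lt_one
    have hrinv : (r : N)⁻¹ ∈ R := by
      rw [hR]
      intro V hV
      have h1 : ¬ V.valuation (r : N) < 1 :=
        fun h => hcon' ⟨V, hV⟩ ((hφ V (hmemF ⟨V, hV⟩) r).mpr h)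
      have h2 : V.valuation (r : N) ≤ 1 := (V.valuation_le_one_iff _).mpr (hmemF ⟨V, hV⟩ r r.2)
      have h3 : V.valuation (r : N) = 1 := le_antisymm h2 (not_lt.mp h1)
      rw [← V.valuation_le_one_iff, map_inv₀, h3, inv_one]
    have h4 : U.valuation (r : N)⁻¹ ≤ 1 := (U.valuation_le_one_iff _).mpr (hRU _ hrinv)
    rw [map_inv₀, inv_le_one₀ ((Valuation.pos_iff _).mpr hr0)] at h4
    exact not_lt_of_ge h4 hrU
  -- prime avoidance
  obtain ⟨V₀, hV₀⟩ := hF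
  have hprime : ∀ V ∈ (Finset.univ : Finset F), V ≠ ⟨V₀, hV₀⟩ → V ≠ ⟨V₀, hV₀⟩ →
      (p V).IsPrime :=
    fun V _ _ _ => Ideal.comap_isPrime _ _
  obtain ⟨V₁, -, hPV₁⟩ := (Ideal.subset_union_prime ⟨V₀, hV₀⟩ ⟨V₀, hV₀⟩ hprime).mp hPsub
  -- `V₁ ≤ U`
  refine ⟨V₁, V₁.2, fun x hx => ?_⟩
  obtain ⟨s, t, hst, hs1, hsx⟩ := exists_unit_mul_eq_of_isAlgebraic O (V₁ : ValuationSubring N)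
    (hFO _ V₁.2) hx (Algebra.IsAlgebraic.isAlgebraic x)
  have hstR : s ∈ R ∧ t ∈ R := by
    have : ∀ V ∈ F, s ∈ V ∧ t ∈ V :=
      fun V hV => hst V fun c hc => algebraMap_mem_valuationSubring_of_comap_eq (hFO V hV) hc
    exact ⟨(hR s).mpr fun V hV => (this V hV).1, (hR t).mpr fun V hV => (this V hV).2⟩
  have hs0 : s ≠ 0 := by
    intro h
    rw [h, map_zero] at hs1
    exact zero_ne_one hs1
  have hsP : (⟨s, hstR.1⟩ : R) ∉ P := by
    intro hsP
    have := hPV₁ hsP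
    rw [hφ] at this
    exact absurd hs1 (ne_of_lt this)
  have hsU : ¬ U.valuation s < 1 := fun h => hsP ((hφ U hRU ⟨s, hstR.1⟩).mpr h)
  have hsU1 : U.valuation s = 1 :=
    le_antisymm ((U.valuation_le_one_iff _).mpr (hRU _ hstR.1)) (not_lt.mp hsU)
  have hsinv : s⁻¹ ∈ U := by
    rw [← U.valuation_le_one_iff, map_inv₀, hsU1, inv_one]
  have : x = s⁻¹ * t := by
    rw [← hsx, ← mul_assoc, inv_mul_cancel₀ hs0, one_mul]
  rw [this]
  exact U.mul_mem _ _ hsinv (hRU _ hstR.2)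

end Literature.AlgebraicGeometry.Resolution
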